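import Literature.Computability.AlgebraicComplexity.SymmetricArithCircuit
import Mathlib.Data.Fintype.Sum
import Mathlib.Logic.Embedding.Basic
import Mathlib.Logic.Equiv.Sum
import HarnessLib

/-!
# Symmetric circuits: pairing two symmetric circuits (disjoint union with shared inputs)

Topic `Computability/AlgebraicComplexity`, namespace `Literature.Computability.AlgebraicComplexity`.

A closure property of Dawar–Wilsenach symmetric arithmetic circuits
(`SymmetricArithCircuit.lean`: `LabelledArithCircuit` = Def. 2.2, `IsAutomorphismExtending` =
Def. 3.6, `IsSymmetric` = Def. 3.7 of A. Dawar, G. Wilsenach, *Symmetric Arithmetic Circuits*,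
Theory of Computing 21 (2025)): two `Γ`-symmetric labelled circuits `C₁`, `C₂` over the same
constants `K` and variables `X`, with outputs indexed by `Γ`-sets `Y₁`, `Y₂`, merge into ONE
`Γ`-symmetric circuit with outputs indexed by `Y₁ ⊕ Y₂` computing both output families, on
exactly `|G₁| + |G₂|` gates (`LabelledArithCircuit.IsSymmetric.exists_pairing`). This is the
infrastructure behind "sums and products of symmetrically computable families are symmetrically
computable".

The only obstacle to the plain disjoint union is the clause of Def. 2.2 "distinct input gates have
distinct labels" (`eq_of_label_eq`). Construction (`LabelledArithCircuit.Pairing.circuit`): gate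
set `G₁ ⊕ G₂`; a gate `g₂` of `C₂` is DUPLICATED (`IsDup`) if it is an input gate whose label is
already the label of a (necessarily unique, input) gate of `C₁`, its TWIN (`twin`); a duplicated
gate becomes a unary `+` gate whose only child is (the copy of) its twin — so its value is
unchanged — and every other label and wire is kept. An automorphism pair `(π₁, π₂)` extending
`γ` acts as `π₁ ⊕ π₂` (`Equiv.sumCongr`): the set of input labels of `C₁` is `γ`-stable, so
being duplicated is preserved (`isDup_apply_iff`) and twins go to twins (`twin_apply`).
Everything is folklore and proved; nothing here is a named fact.
-/

noncomputable section

open scoped Classical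

namespace Literature.Computability.AlgebraicComplexity

open MvPolynomial

universe u v w₁ w₂

namespace LabelledArithCircuit

namespace Pairing

variable {K : Type u} {X : Type v} {Y₁ Y₂ : Type*} {G₁ : Type w₁} {G₂ : Type w₂}
  (C₁ : LabelledArithCircuit K X Y₁ G₁) (C₂ : LabelledArithCircuit K X Y₂ G₂)

/-! ### Duplicated input gates and their twins -/

/-- A gate of the second circuit is DUPLICATED if it is an input gate (label in `X ∪ K`) whose
label is already carried by some gate of the first circuit (Def. 2.2 forbids two input gates with
the same label in one circuit). [cite: DawarWilsenach2025, Def. 2.2] -/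
def IsDup (g₂ : G₂) : Prop := (C₂.label g₂).IsInput ∧ ∃ g₁, C₁.label g₁ = C₂.label g₂

variable {C₁ C₂}

/-- The TWIN of a duplicated gate: the gate of the first circuit with the same (input) label.
[cite: DawarWilsenach2025, Def. 2.2] -/
def twin {g₂ : G₂} (h : IsDup C₁ C₂ g₂) : G₁ := h.2.choose

/-- The twin carries the same label. [cite: DawarWilsenach2025, Def. 2.2] -/
theorem label_twin {g₂ : G₂} (h : IsDup C₁ C₂ g₂) : C₁.label (twin h) = C₂.label g₂ :=
  h.2.choose_spec

/-- The twin is an input gate. [cite: DawarWilsenach2025, Def. 2.2] -/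
theorem isInput_label_twin {g₂ : G₂} (h : IsDup C₁ C₂ g₂) : (C₁.label (twin h)).IsInput := by
  rw [label_twin h]; exact h.1

variable (C₁ C₂)

/-! ### The construction -/

/-- Children in the paired circuit: the children of a gate of `C₁` are its old children; a
duplicated gate of `C₂` has its twin as only child; any other gate of `C₂` keeps its old
children. [cite: DawarWilsenach2025, Def. 2.2] -/
def children : G₁ ⊕ G₂ → Finset (G₁ ⊕ G₂)
  | .inl g₁ => (C₁.children g₁).map Function.Embedding.inl
  | .inr g₂ =>
    if h : IsDup C₁ C₂ g₂ then {Sum.inl (twin h)} else (C₂.children g₂).map Function.Embedding.inr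

/-- Labels in the paired circuit: old labels, except that a duplicated gate becomes a (unary)
addition gate. [cite: DawarWilsenach2025, Def. 2.2] -/
def label : G₁ ⊕ G₂ → CircuitLabel K X
  | .inl g₁ => C₁.label g₁
  | .inr g₂ => if IsDup C₁ C₂ g₂ then .add else C₂.label g₂

/-- Children of a gate coming from `C₁`. [cite: DawarWilsenach2025, Def. 2.2] -/
theorem children_inl (g₁ : G₁) :
    children C₁ C₂ (.inl g₁) = (C₁.children g₁).map Function.Embedding.inl := rfl

/-- Label of a gate coming from `C₁`. [cite: DawarWilsenach2025, Def. 2.2] -/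
theorem label_inl (g₁ : G₁) : label C₁ C₂ (.inl g₁) = C₁.label g₁ := rfl

variable {C₁ C₂}

/-- Children of a duplicated gate: its twin. [cite: DawarWilsenach2025, Def. 2.2] -/
theorem children_inr_of_isDup {g₂ : G₂} (h : IsDup C₁ C₂ g₂) :
    children C₁ C₂ (.inr g₂) = {Sum.inl (twin h)} := by
  simp only [children, dif_pos h]

/-- Children of a non-duplicated gate coming from `C₂`. [cite: DawarWilsenach2025, Def. 2.2] -/
theorem children_inr_of_not_isDup {g₂ : G₂} (h : ¬ IsDup C₁ C₂ g₂) :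
    children C₁ C₂ (.inr g₂) = (C₂.children g₂).map Function.Embedding.inr := by
  simp only [children, dif_neg h]

/-- A duplicated gate is relabelled `+`. [cite: DawarWilsenach2025, Def. 2.2] -/
theorem label_inr_of_isDup {g₂ : G₂} (h : IsDup C₁ C₂ g₂) : label C₁ C₂ (.inr g₂) = .add := by
  simp only [label, if_pos h]

/-- A non-duplicated gate coming from `C₂` keeps its label. [cite: DawarWilsenach2025, Def. 2.2] -/
theorem label_inr_of_not_isDup {g₂ : G₂} (h : ¬ IsDup C₁ C₂ g₂) :
    label C₁ C₂ (.inr g₂) = C₂.label g₂ := by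
  simp only [label, if_neg h]

/-! #### Acyclicity -/

/-- Gates coming from `C₁` are accessible (acyclicity of `C₁`). [cite: DawarWilsenach2025, Def. 2.2] -/
theorem acc_inl (g₁ : G₁) : Acc (fun a b : G₁ ⊕ G₂ => a ∈ children C₁ C₂ b) (.inl g₁) := by
  induction g₁ using C₁.wf.induction with
  | h g ih =>
    refine Acc.intro _ fun a ha => ?_
    simp only [children, Finset.mem_map, Function.Embedding.inl_apply] at ha
    obtain ⟨h, hh, rfl⟩ := ha
    exact ih h hh

/-- Gates coming from `C₂` are accessible (acyclicity of `C₂`, twins being accessible).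
[cite: DawarWilsenach2025, Def. 2.2] -/
theorem acc_inr (g₂ : G₂) : Acc (fun a b : G₁ ⊕ G₂ => a ∈ children C₁ C₂ b) (.inr g₂) := by
  induction g₂ using C₂.wf.induction with
  | h g ih =>
    refine Acc.intro _ fun a ha => ?_
    by_cases hd : IsDup C₁ C₂ g
    · rw [children_inr_of_isDup hd, Finset.mem_singleton] at ha
      rw [ha]
      exact acc_inl _
    · simp only [children_inr_of_not_isDup hd, Finset.mem_map, Function.Embedding.inr_apply] at ha
      obtain ⟨h, hh, rfl⟩ := ha
      exact ih h hh

/-- The child relation of the paired circuit is well founded. [cite: DawarWilsenach2025, Def. 2.2] -/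
theorem wf : WellFounded fun a b : G₁ ⊕ G₂ => a ∈ children C₁ C₂ b :=
  ⟨fun a => match a with
    | .inl g₁ => acc_inl g₁
    | .inr g₂ => acc_inr g₂⟩

/-! #### The labelled circuit -/

/-- Input labels exactly at the gates without children. [cite: DawarWilsenach2025, Def. 2.2] -/
theorem isInput_iff (a : G₁ ⊕ G₂) : (label C₁ C₂ a).IsInput ↔ children C₁ C₂ a = ∅ := by
  cases a with
  | inl g₁ => simp only [label, children, Finset.map_eq_empty]; exact C₁.isInput_iff g₁
  | inr g₂ =>
    by_cases hd : IsDup C₁ C₂ g₂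
    · simp [label_inr_of_isDup hd, children_inr_of_isDup hd]
    · simp only [label_inr_of_not_isDup hd, children_inr_of_not_isDup hd, Finset.map_eq_empty]
      exact C₂.isInput_iff g₂

/-- Labels are injective on input gates: within each circuit by hypothesis, across the two
circuits because a gate of `C₂` sharing an input label with `C₁` has been relabelled `+`.
[cite: DawarWilsenach2025, Def. 2.2] -/
theorem eq_of_label_eq (a b : G₁ ⊕ G₂) (ha : (label C₁ C₂ a).IsInput)
    (hab : label C₁ C₂ a = label C₁ C₂ b) : a = b := by
  cases a with
  | inl g₁ =>
    rw [label_inl] at ha hab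
    cases b with
    | inl g₁' => exact congrArg Sum.inl (C₁.eq_of_label_eq g₁ g₁' ha hab)
    | inr g₂' =>
      by_cases hd : IsDup C₁ C₂ g₂'
      · rw [label_inr_of_isDup hd] at hab
        rw [hab] at ha
        exact absurd ha (by simp)
      · rw [label_inr_of_not_isDup hd] at hab
        exact absurd ⟨hab ▸ ha, g₁, hab⟩ hd
  | inr g₂ =>
    by_cases hd : IsDup C₁ C₂ g₂
    · rw [label_inr_of_isDup hd] at ha
      exact absurd ha (by simp)
    · rw [label_inr_of_not_isDup hd] at ha hab
      cases b with
      | inl g₁' => exact absurd ⟨ha, g₁', hab.symm⟩ hd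
      | inr g₂' =>
        by_cases hd' : IsDup C₁ C₂ g₂'
        · rw [label_inr_of_isDup hd'] at hab
          rw [hab] at ha
          exact absurd ha (by simp)
        · rw [label_inr_of_not_isDup hd'] at hab
          exact congrArg Sum.inr (C₂.eq_of_label_eq g₂ g₂' ha hab)

variable (C₁ C₂)

/-- **The paired circuit** of `C₁` and `C₂` (module docstring): gate set `G₁ ⊕ G₂`, outputs
`Y₁ ⊕ Y₂` (`Sum.inl y ↦ output of C₁ at y`, `Sum.inr y ↦ output of C₂ at y`), duplicated input
gates of `C₂` rewired to their twins in `C₁`. [cite: DawarWilsenach2025, Def. 2.2] -/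
def circuit : LabelledArithCircuit K X (Y₁ ⊕ Y₂) (G₁ ⊕ G₂) where
  children := children C₁ C₂
  label := label C₁ C₂
  output := Sum.map C₁.output C₂.output
  wf := wf
  isInput_iff := isInput_iff
  eq_of_label_eq := eq_of_label_eq
  output_injective := C₁.output_injective.sumMap C₂.output_injective

variable {C₁ C₂}

/-! ### Semantics -/

section Eval

variable [CommSemiring K]

/-- Gates coming from `C₁` keep their values. [cite: DawarWilsenach2025, §2 (evaluation)] -/
theorem eval_inl (g₁ : G₁) : (circuit C₁ C₂).eval (.inl g₁) = C₁.eval g₁ := by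
  induction g₁ using C₁.wf.induction with
  | h g ih =>
    have hlab : (circuit C₁ C₂).label (.inl g) = C₁.label g := rfl
    have hch : (circuit C₁ C₂).children (.inl g) = (C₁.children g).map Function.Embedding.inl :=
      rfl
    rcases hl : C₁.label g with x | c | _ | _
    · rw [C₁.eval_of_label_var hl, (circuit C₁ C₂).eval_of_label_var (hlab.trans hl)]
    · rw [C₁.eval_of_label_const hl, (circuit C₁ C₂).eval_of_label_const (hlab.trans hl)]
    · rw [C₁.eval_of_label_add hl, (circuit C₁ C₂).eval_of_label_add (hlab.trans hl), hch,
        Finset.sum_map]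
      exact Finset.sum_congr rfl fun h hh => ih h hh
    · rw [C₁.eval_of_label_mul hl, (circuit C₁ C₂).eval_of_label_mul (hlab.trans hl), hch,
        Finset.prod_map]
      exact Finset.prod_congr rfl fun h hh => ih h hh

/-- Gates coming from `C₂` keep their values (a duplicated input gate now copies the value of
its twin, which carries the same input label). [cite: DawarWilsenach2025, §2 (evaluation)] -/
theorem eval_inr (g₂ : G₂) : (circuit C₁ C₂).eval (.inr g₂) = C₂.eval g₂ := by
  induction g₂ using C₂.wf.induction with
  | h g ih =>
    by_cases hd : IsDup C₁ C₂ g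
    · have hlab : (circuit C₁ C₂).label (.inr g) = .add := label_inr_of_isDup hd
      have hch : (circuit C₁ C₂).children (.inr g) = {Sum.inl (twin hd)} :=
        children_inr_of_isDup hd
      rw [(circuit C₁ C₂).eval_of_label_add hlab, hch, Finset.sum_singleton, eval_inl]
      have hspec : C₁.label (twin hd) = C₂.label g := label_twin hd
      rcases hl : C₂.label g with x | c | _ | _
      · rw [C₂.eval_of_label_var hl, C₁.eval_of_label_var (hspec.trans hl)]
      · rw [C₂.eval_of_label_const hl, C₁.eval_of_label_const (hspec.trans hl)]
      · exact absurd hd.1 (by rw [hl]; simp)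
      · exact absurd hd.1 (by rw [hl]; simp)
    · have hlab : (circuit C₁ C₂).label (.inr g) = C₂.label g := label_inr_of_not_isDup hd
      have hch : (circuit C₁ C₂).children (.inr g) =
          (C₂.children g).map Function.Embedding.inr := children_inr_of_not_isDup hd
      rcases hl : C₂.label g with x | c | _ | _
      · rw [C₂.eval_of_label_var hl, (circuit C₁ C₂).eval_of_label_var (hlab.trans hl)]
      · rw [C₂.eval_of_label_const hl, (circuit C₁ C₂).eval_of_label_const (hlab.trans hl)]
      · rw [C₂.eval_of_label_add hl, (circuit C₁ C₂).eval_of_label_add (hlab.trans hl), hch,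
          Finset.sum_map]
        exact Finset.sum_congr rfl fun h hh => ih h hh
      · rw [C₂.eval_of_label_mul hl, (circuit C₁ C₂).eval_of_label_mul (hlab.trans hl), hch,
          Finset.prod_map]
        exact Finset.prod_congr rfl fun h hh => ih h hh

/-- **Semantics, first family.** The output indexed `Sum.inl y` computes what `C₁` computes at
`y`. [cite: DawarWilsenach2025, §2 (evaluation)] -/
theorem eval_output_inl (y : Y₁) :
    (circuit C₁ C₂).eval ((circuit C₁ C₂).output (.inl y)) = C₁.eval (C₁.output y) :=
  eval_inl (C₁.output y)

/-- **Semantics, second family.** The output indexed `Sum.inr y` computes what `C₂` computes at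
`y`. [cite: DawarWilsenach2025, §2 (evaluation)] -/
theorem eval_output_inr (y : Y₂) :
    (circuit C₁ C₂).eval ((circuit C₁ C₂).output (.inr y)) = C₂.eval (C₂.output y) :=
  eval_inr (C₂.output y)

end Eval

/-! ### Symmetry -/

section Symmetry

variable {Γ : Type*} [Group Γ] [MulAction Γ X] [MulAction Γ Y₁] [MulAction Γ Y₂]
  {γ : Γ} {π₁ : Equiv.Perm G₁} {π₂ : Equiv.Perm G₂}

/-- Along a pair of automorphisms extending `γ`, being duplicated is preserved: labels move by
`γ`, which preserves input labels (Def. 3.6), and the set of labels of `C₁` is `γ`-stable because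
`π₁` permutes the gates of `C₁`. [cite: DawarWilsenach2025, Def. 3.6] -/
theorem isDup_apply_iff (hπ₁ : C₁.IsAutomorphismExtending γ π₁)
    (hπ₂ : C₂.IsAutomorphismExtending γ π₂) (g₂ : G₂) :
    IsDup C₁ C₂ (π₂ g₂) ↔ IsDup C₁ C₂ g₂ := by
  unfold IsDup
  rw [hπ₂.label_apply, CircuitLabel.isInput_smul]
  refine and_congr_right fun _ => ⟨?_, ?_⟩
  · rintro ⟨g₁, hg₁⟩
    refine ⟨π₁.symm g₁, smul_left_cancel γ ?_⟩
    rw [← hπ₁.label_apply, Equiv.apply_symm_apply, hg₁]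
  · rintro ⟨g₁, hg₁⟩
    exact ⟨π₁ g₁, by rw [hπ₁.label_apply, hg₁]⟩

/-- Twins go to twins: the twin of `π₂ g₂` is `π₁` of the twin of `g₂` (both are input gates of
`C₁` labelled `γ •` the label of `g₂`). [cite: DawarWilsenach2025, Def. 3.6] -/
theorem twin_apply (hπ₁ : C₁.IsAutomorphismExtending γ π₁)
    (hπ₂ : C₂.IsAutomorphismExtending γ π₂) {g₂ : G₂} (h : IsDup C₁ C₂ g₂)
    (h' : IsDup C₁ C₂ (π₂ g₂)) : twin h' = π₁ (twin h) := by
  refine C₁.eq_of_label_eq _ _ (isInput_label_twin h') ?_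
  rw [label_twin h', hπ₂.label_apply, hπ₁.label_apply, label_twin h]

/-- **Symmetry.** If `π₁`, `π₂` are automorphisms of `C₁`, `C₂` extending `γ` then `π₁ ⊕ π₂` is an
automorphism of the paired circuit extending `γ`. [cite: DawarWilsenach2025, Def. 3.6] -/
theorem isAutomorphismExtending_sumCongr (hπ₁ : C₁.IsAutomorphismExtending γ π₁)
    (hπ₂ : C₂.IsAutomorphismExtending γ π₂) :
    (circuit C₁ C₂).IsAutomorphismExtending γ (Equiv.sumCongr π₁ π₂) := by
  refine ⟨?_, ?_, ?_⟩
  · rintro (g₁ | g₂)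
    · change children C₁ C₂ (.inl (π₁ g₁)) =
        (children C₁ C₂ (.inl g₁)).map (Equiv.sumCongr π₁ π₂).toEmbedding
      rw [children_inl, children_inl, hπ₁.children_apply, Finset.map_map, Finset.map_map]
      rfl
    · change children C₁ C₂ (.inr (π₂ g₂)) =
        (children C₁ C₂ (.inr g₂)).map (Equiv.sumCongr π₁ π₂).toEmbedding
      by_cases hd : IsDup C₁ C₂ g₂
      · have hd' : IsDup C₁ C₂ (π₂ g₂) := (isDup_apply_iff hπ₁ hπ₂ g₂).2 hd
        rw [children_inr_of_isDup hd', children_inr_of_isDup hd, Finset.map_singleton,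
          twin_apply hπ₁ hπ₂ hd hd']
        rfl
      · have hd' : ¬ IsDup C₁ C₂ (π₂ g₂) := fun h => hd ((isDup_apply_iff hπ₁ hπ₂ g₂).1 h)
        rw [children_inr_of_not_isDup hd', children_inr_of_not_isDup hd, hπ₂.children_apply,
          Finset.map_map, Finset.map_map]
        rfl
  · rintro (g₁ | g₂)
    · exact hπ₁.label_apply g₁
    · change label C₁ C₂ (.inr (π₂ g₂)) = γ • label C₁ C₂ (.inr g₂)
      by_cases hd : IsDup C₁ C₂ g₂
      · have hd' : IsDup C₁ C₂ (π₂ g₂) := (isDup_apply_iff hπ₁ hπ₂ g₂).2 hd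
        rw [label_inr_of_isDup hd', label_inr_of_isDup hd, CircuitLabel.smul_add]
      · have hd' : ¬ IsDup C₁ C₂ (π₂ g₂) := fun h => hd ((isDup_apply_iff hπ₁ hπ₂ g₂).1 h)
        rw [label_inr_of_not_isDup hd', label_inr_of_not_isDup hd, hπ₂.label_apply]
  · rintro (y | y)
    · change Sum.map C₁.output C₂.output (γ • Sum.inl y : Y₁ ⊕ Y₂) = Sum.inl (π₁ (C₁.output y))
      rw [Sum.smul_inl, Sum.map_inl, hπ₁.output_smul]
    · change Sum.map C₁.output C₂.output (γ • Sum.inr y : Y₁ ⊕ Y₂) = Sum.inr (π₂ (C₂.output y))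
      rw [Sum.smul_inr, Sum.map_inr, hπ₂.output_smul]

/-- A pair of `Γ`-symmetric circuits gives a `Γ`-symmetric paired circuit (Def. 3.7).
[cite: DawarWilsenach2025, Def. 3.7] -/
theorem isSymmetric (h₁ : C₁.IsSymmetric Γ) (h₂ : C₂.IsSymmetric Γ) :
    (circuit C₁ C₂).IsSymmetric Γ := by
  intro γ
  obtain ⟨π₁, hπ₁⟩ := h₁ γ
  obtain ⟨π₂, hπ₂⟩ := h₂ γ
  exact ⟨Equiv.sumCongr π₁ π₂, isAutomorphismExtending_sumCongr hπ₁ hπ₂⟩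

end Symmetry

/-! ### Size -/

/-- **Size.** The paired circuit has exactly `|G₁| + |G₂|` gates. [cite: DawarWilsenach2025, Def. 2.2 (size)] -/
theorem card_gate [Fintype G₁] [Fintype G₂] :
    Fintype.card (G₁ ⊕ G₂) = Fintype.card G₁ + Fintype.card G₂ :=
  Fintype.card_sum

end Pairing

/-- **Pairing of symmetric circuits.** For any group `Γ` acting on the variables `X` and on the
output index sets `Y₁`, `Y₂`: two `Γ`-symmetric labelled circuits over `K`, `X` with outputs
indexed by `Y₁` and `Y₂` merge into one `Γ`-symmetric labelled circuit with outputs indexed by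
`Y₁ ⊕ Y₂` computing both output families, on at most `|G₁| + |G₂|` gates (Dawar–Wilsenach
Defs. 2.2, 3.6, 3.7; the construction is `Pairing.circuit`). [cite: DawarWilsenach2025, Def. 3.7] -/
theorem IsSymmetric.exists_pairing {K : Type u} [CommSemiring K] {X : Type v} {Y₁ Y₂ : Type*}
    {G₁ : Type w₁} {G₂ : Type w₂} [Fintype G₁] [Fintype G₂] {Γ : Type*} [Group Γ]
    [MulAction Γ X] [MulAction Γ Y₁] [MulAction Γ Y₂]
    {C₁ : LabelledArithCircuit K X Y₁ G₁} {C₂ : LabelledArithCircuit K X Y₂ G₂}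
    (h₁ : C₁.IsSymmetric Γ) (h₂ : C₂.IsSymmetric Γ) :
    ∃ (G : Type (max w₁ w₂)) (_ : Fintype G) (C : LabelledArithCircuit K X (Y₁ ⊕ Y₂) G),
      C.IsSymmetric Γ ∧
      (∀ y, C.eval (C.output (Sum.inl y)) = C₁.eval (C₁.output y)) ∧
      (∀ y, C.eval (C.output (Sum.inr y)) = C₂.eval (C₂.output y)) ∧
      Fintype.card G ≤ Fintype.card G₁ + Fintype.card G₂ :=
  ⟨G₁ ⊕ G₂, inferInstance, Pairing.circuit C₁ C₂, Pairing.isSymmetric h₁ h₂,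
    Pairing.eval_output_inl, Pairing.eval_output_inr, Pairing.card_gate.le⟩

end LabelledArithCircuit

end Literature.Computability.AlgebraicComplexity

end
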